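import Literature.MathematicalPhysics.QuantumLattice.MatsubaraDeterminantBound
import Literature.MathematicalPhysics.QuantumLattice.HubbardLinkedCluster
import Literature.MathematicalPhysics.QuantumLattice.DuhamelTwoPoint
import Literature.Analysis.Matrix.DetAddDiagonalMinors
import HarnessLib

/-!
# The temperature-uniform `2ⁿ` bound for time-ordered propagator determinants `det (propMatrix β h ⋯)`

The coefficients of the determinant (Dyson) expansions of lattice fermion partition functions and
Schwinger functions around a quasi-free Hamiltonian `dΓ(h)` (`HubbardDysonDeterminant`,
`HubbardLinkedCluster`, `DWaveSourceDysonSeries`, `DWaveSourceShiftedDysonSeries`,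
`ShiftedHubbardDysonDeterminant`) are determinants of the pair-indexed matrix of time-ordered free
propagators `propMatrix β h op om τ` (`HubbardLinkedCluster.propMatrix`): entry `(a, b)` is
`[e^{-τ_b h}(1+e^{βh})⁻¹e^{τ_a h}]_{om b, op a}` if `a ≤ b` and `-[e^{-τ_b h}(1+e^{-βh})⁻¹e^{τ_a h}]_{om b, op a}`
otherwise. The tree's bound `ShiftedDeterminantBound.norm_det_propMatrix_le` (from the CAR-norm Gram
form, `FermionDeterminantBound`) carries the factors `‖e^{τₐh}‖ ~ e^{|τₐ|‖h‖}`, i.e. `e^{β‖h‖}` per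
row at low temperature — useless for a multiscale analysis. The sharp remedy is the Matsubara-UV
determinant bound of de Siqueira Pedra–Salmhofer (CMP 282 (2008) 797, Thm 2.4), in the tree in MODE
form as `MatsubaraDeterminantBound.norm_det_timeOrdered_modes_le`: `|det| ≤ 2ⁿ ∏‖Fₐ‖₂ ∏‖G_b‖₂`,
uniformly in `β`, the energies and the number of modes, provided the times are CHRONOLOGICAL
(creation of pair `a` to the left of the annihilation of pair `b` forces `t_b ≤ s_a`, and conversely).

This file transports that bound to `propMatrix` (Benfatto–Giuliani–Mastropietro 2006, (2.80):
"`|det G| ≤ Cⁿ`, Gram–Hadamard"):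

* `Matrix.IsHermitian.exp_real_smul_eq_conj_diagonal`, `…inv_one_add_exp_real_smul_eq_conj_diagonal`,
  `…propagatorKernel_apply` — the spectral form of the free propagator kernel in an eigenbasis
  `h = U diag(d) U⋆`: `[e^{-th}(1+e^{βh})⁻¹e^{sh}]_{ij} = Σₘ U_{im} conj(U_{jm}) e^{(s-t)dₘ}/(1+e^{βdₘ})`
  (and the same with `(1+e^{-βh})⁻¹`), i.e. `propMatrix` IS a matrix of time-ordered mode
  contractions with the unit mode vectors `Fₐ = conj U_{op a, ·}`, `G_b = U_{om b, ·}`;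
* **`norm_det_propMatrix_le_two_pow`** — for Hermitian `h`, any `β`, and REAL pair times `tₐ` that are
  antitone in the pair index (earlier pairs act at later times — the chronological order of every
  Dyson term) and lie in a window `[τ₀, τ₀ + β]`:
  `‖det (propMatrix β h op om t)‖ ≤ 2ⁿ` — no `n!`, no `e^{β‖h‖}`, no dependence on `h` or the volume;
* `norm_det_propMatrix_dyson_le_two_pow` — the same in the time convention of the tree's Dyson series
  (`τₐ = -β uₐ`, `u` monotone in `[0, 1]`, `0 ≤ β`);
* **`norm_det_propMatrix_sub_diagonal_le_prod_two_add`** — the SHIFTED (tadpole-subtracted)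
  determinants of a renormalised expansion: `‖det (propMatrix β h op om t − diagonal d)‖ ≤ ∏ₐ (2 + ‖dₐ‖)`
  (principal-minor expansion `Literature.Analysis.Matrix.det_add_diagonal_eq_sum_minors`; every
  principal minor is again a chronological `propMatrix`, `propMatrix_submatrix`).

Everything is PROVED; no definition and no named fact.

## Mathlib / tree search
Tree: `norm_det_timeOrdered_modes_le` (`MatsubaraDeterminantBound`), `propMatrix`,
`propMatrix_submatrix` (`HubbardLinkedCluster`), `Matrix.IsHermitian.gibbsWeight_eq`,
`Matrix.sum_norm_sq_row_eq_one` (`DuhamelTwoPoint`), `det_add_diagonal_eq_sum_minors`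
(`Literature.Analysis.Matrix.DetAddDiagonalMinors`), `norm_det_propMatrix_sub_diagonal_le`
(`ShiftedDeterminantBound`, the `e^{|τ|‖h‖}` version). Mathlib: `Matrix.inv_eq_left_inv`,
`Unitary.mul_star_self_of_mem`, `Matrix.diagonal_mul_diagonal`, `Antitone.comp_monotone`.

## References
* W. de Siqueira Pedra, M. Salmhofer, Comm. Math. Phys. 282 (2008) 797–818, Thm 2.4, Cor. 4.2.
  [cite: PedraSalmhofer2008, Thm 2.4]
* G. Benfatto, A. Giuliani, V. Mastropietro, Ann. Henri Poincaré 7 (2006) 809–898, §2.8 (2.80).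
  [cite: BenfattoGiulianiMastropietro2006, §2.8 (2.80)]
-/

noncomputable section

open scoped Matrix ComplexOrder
open Finset NormedSpace

/-! ### Spectral form of the free propagator kernel -/

namespace Matrix

variable {ι : Type*} [Fintype ι] [DecidableEq ι]

/-- Entries of `V diag(c) V⋆`: `(V diag(c) V⋆)ᵢⱼ = Σₘ Vᵢₘ cₘ conj(Vⱼₘ)`. [folklore] -/
theorem conj_diagonal_apply (V : Matrix ι ι ℂ) (c : ι → ℂ) (i j : ι) :
    (V * diagonal c * star V) i j = ∑ m, V i m * c m * star (V j m) := by
  rw [mul_apply]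
  refine Finset.sum_congr rfl fun m _ => ?_
  rw [mul_diagonal, star_apply]

/-- `(U diag(f) U⋆)(U diag(g) U⋆) = U diag(f g) U⋆` for unitary `U`. [folklore] -/
theorem conj_diagonal_mul_conj_diagonal {U : Matrix ι ι ℂ} (hU : U ∈ unitary (Matrix ι ι ℂ))
    (f g : ι → ℂ) :
    U * diagonal f * star U * (U * diagonal g * star U) =
      U * diagonal (fun i => f i * g i) * star U := by
  calc U * diagonal f * star U * (U * diagonal g * star U)
      = U * diagonal f * (star U * U) * diagonal g * star U := by simp only [Matrix.mul_assoc]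
    _ = U * diagonal (fun i => f i * g i) * star U := by
        rw [Unitary.star_mul_self_of_mem hU, Matrix.mul_one, Matrix.mul_assoc U,
          diagonal_mul_diagonal]

/-- `1 + U diag(f) U⋆ = U diag(1 + f) U⋆` for unitary `U`. [folklore] -/
theorem one_add_conj_diagonal {U : Matrix ι ι ℂ} (hU : U ∈ unitary (Matrix ι ι ℂ)) (f : ι → ℂ) :
    1 + U * diagonal f * star U = U * diagonal (fun i => 1 + f i) * star U := by
  have h1 : U * diagonal (fun _ : ι => (1 : ℂ)) * star U = 1 := by
    rw [diagonal_one, Matrix.mul_one, Unitary.mul_star_self_of_mem hU]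
  rw [← diagonal_add, Matrix.mul_add, Matrix.add_mul, h1]

/-- **`e^{τh} = U diag(e^{τdᵢ}) U⋆`** for Hermitian `h` and real `τ`, in the eigenbasis of the spectral
theorem (`Matrix.IsHermitian.gibbsWeight_eq` at inverse temperature `-τ`). [folklore] -/
theorem IsHermitian.exp_real_smul_eq_conj_diagonal {h : Matrix ι ι ℂ} (hh : h.IsHermitian) (τ : ℝ) :
    NormedSpace.exp ((τ : ℂ) • h) = (hh.eigenvectorUnitary : Matrix ι ι ℂ) *
      diagonal (fun i => (Real.exp (τ * hh.eigenvalues i) : ℂ)) *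
        star (hh.eigenvectorUnitary : Matrix ι ι ℂ) := by
  have h1 : gibbsWeight (-τ) h = NormedSpace.exp ((τ : ℂ) • h) := by
    simp only [gibbsWeight, Complex.ofReal_neg, neg_neg]
  have h2 : (fun i => (Real.exp (-(-τ * hh.eigenvalues i)) : ℂ)) =
      fun i => (Real.exp (τ * hh.eigenvalues i) : ℂ) := by
    funext i
    rw [neg_mul, neg_neg]
  rw [← h1, hh.gibbsWeight_eq, h2]

/-- **The Fermi factor in the eigenbasis**: `(1 + e^{βh})⁻¹ = U diag((1 + e^{βdᵢ})⁻¹) U⋆` for Hermitian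
`h` and real `β` (`U diag((1+e^{βd})⁻¹) U⋆` is a left inverse of `1 + e^{βh} = U diag(1+e^{βd}) U⋆`).
[folklore] -/
theorem IsHermitian.inv_one_add_exp_real_smul_eq_conj_diagonal {h : Matrix ι ι ℂ} (hh : h.IsHermitian)
    (β : ℝ) :
    (1 + NormedSpace.exp ((β : ℂ) • h))⁻¹ = (hh.eigenvectorUnitary : Matrix ι ι ℂ) *
      diagonal (fun i => (((1 + Real.exp (β * hh.eigenvalues i))⁻¹ : ℝ) : ℂ)) *
        star (hh.eigenvectorUnitary : Matrix ι ι ℂ) := by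
  have hU : (hh.eigenvectorUnitary : Matrix ι ι ℂ) ∈ unitary (Matrix ι ι ℂ) :=
    hh.eigenvectorUnitary.prop
  refine Matrix.inv_eq_left_inv ?_
  rw [hh.exp_real_smul_eq_conj_diagonal β, one_add_conj_diagonal hU,
    conj_diagonal_mul_conj_diagonal hU]
  have hfun : (fun i => (((1 + Real.exp (β * hh.eigenvalues i))⁻¹ : ℝ) : ℂ) *
      (1 + (Real.exp (β * hh.eigenvalues i) : ℂ))) = fun _ => (1 : ℂ) := by
    funext i
    have hpos : ((1 + Real.exp (β * hh.eigenvalues i) : ℝ) : ℂ) ≠ 0 :=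
      Complex.ofReal_ne_zero.mpr (by positivity)
    have hadd : (1 : ℂ) + (Real.exp (β * hh.eigenvalues i) : ℂ) =
        ((1 + Real.exp (β * hh.eigenvalues i) : ℝ) : ℂ) := by
      rw [Complex.ofReal_add, Complex.ofReal_one]
    rw [hadd, Complex.ofReal_inv, inv_mul_cancel₀ hpos]
  rw [hfun, diagonal_one, Matrix.mul_one, Unitary.mul_star_self_of_mem hU]

/-- **Spectral form of the free propagator kernel** (on-pattern Fermi factor): for Hermitian `h` and
real `s, t, β`,
`[e^{-th}(1+e^{βh})⁻¹e^{sh}]ᵢⱼ = Σₘ Uᵢₘ · conj(Uⱼₘ) · e^{(s-t)dₘ}/(1+e^{βdₘ})`. The same statement with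
`β ↦ -β` is the off-pattern factor `(1+e^{-βh})⁻¹`. Bratteli–Robinson II §5.2 (quasi-free two-point
functions in the one-particle eigenbasis). [folklore] -/
theorem IsHermitian.propagatorKernel_apply {h : Matrix ι ι ℂ} (hh : h.IsHermitian) (s t β : ℝ)
    (i j : ι) :
    (NormedSpace.exp (-((t : ℂ) • h)) * (1 + NormedSpace.exp ((β : ℂ) • h))⁻¹ * NormedSpace.exp ((s : ℂ) • h)) i j =
      ∑ m, (hh.eigenvectorUnitary : Matrix ι ι ℂ) i m *
        star ((hh.eigenvectorUnitary : Matrix ι ι ℂ) j m) *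
          ((Real.exp ((s - t) * hh.eigenvalues m) * (1 + Real.exp (β * hh.eigenvalues m))⁻¹ : ℝ) : ℂ) := by
  have hU : (hh.eigenvectorUnitary : Matrix ι ι ℂ) ∈ unitary (Matrix ι ι ℂ) :=
    hh.eigenvectorUnitary.prop
  have hneg : -((t : ℂ) • h) = ((-t : ℝ) : ℂ) • h := by
    rw [Complex.ofReal_neg, neg_smul]
  rw [hneg, hh.exp_real_smul_eq_conj_diagonal (-t), hh.inv_one_add_exp_real_smul_eq_conj_diagonal β,
    conj_diagonal_mul_conj_diagonal hU, hh.exp_real_smul_eq_conj_diagonal s,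
    conj_diagonal_mul_conj_diagonal hU, conj_diagonal_apply]
  refine Finset.sum_congr rfl fun m _ => ?_
  have hexp : Real.exp ((s - t) * hh.eigenvalues m) =
      Real.exp (-t * hh.eigenvalues m) * Real.exp (s * hh.eigenvalues m) := by
    rw [← Real.exp_add]
    ring_nf
  rw [hexp]
  push_cast
  ring

end Matrix

namespace Literature.MathematicalPhysics.QuantumLattice

variable {ι : Type*} [Fintype ι] [DecidableEq ι]

/-! ### The `2ⁿ` bound -/

/-- **The temperature-uniform determinant bound for chronological propagator matrices**
(Pedra–Salmhofer 2008, Thm 2.4 / Cor. 4.2; Benfatto–Giuliani–Mastropietro 2006 (2.80)): for a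
Hermitian one-body matrix `h`, any real `β`, creation/annihilation orbitals `op, om` and REAL pair
times `t` that are antitone in the pair index and lie in a window of length `β`,
`‖det (propMatrix β h op om t)‖ ≤ 2ⁿ` — uniformly in `β`, `h` and the number of orbitals.
Proof: in an eigenbasis `h = U diag(d) U⋆` the entries are the time-ordered mode contractions of
`norm_det_timeOrdered_modes_le` with unit mode vectors `Fₐ = conj U_{op a,·}`, `G_b = U_{om b,·}`
(`Matrix.IsHermitian.propagatorKernel_apply`), pattern `a ≤ b`, and shifted clocks `tₐ - τ₀ ∈ [0, β]`;
antitonicity is exactly the time-consistency of the pattern. [cite: PedraSalmhofer2008, Thm 2.4] -/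
theorem norm_det_propMatrix_le_two_pow {h : Matrix ι ι ℂ} (hh : h.IsHermitian) (β τ₀ : ℝ) {n : ℕ}
    (op om : Fin n → ι) (t : Fin n → ℝ) (ht : Antitone t)
    (hwin : ∀ a, τ₀ ≤ t a ∧ t a ≤ τ₀ + β) :
    ‖(propMatrix β h op om (fun a => ((t a : ℝ) : ℂ))).det‖ ≤ 2 ^ n := by
  classical
  have hU : (hh.eigenvectorUnitary : Matrix ι ι ℂ) ∈ unitary (Matrix ι ι ℂ) :=
    hh.eigenvectorUnitary.prop
  -- the mode data
  set F : Fin n → ι → ℂ := fun a m => star ((hh.eigenvectorUnitary : Matrix ι ι ℂ) (op a) m) with hF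
  set G : Fin n → ι → ℂ := fun b m => (hh.eigenvectorUnitary : Matrix ι ι ℂ) (om b) m with hG
  set s : Fin n → ℝ := fun a => t a - τ₀ with hs
  -- `propMatrix` is the matrix of time-ordered mode contractions
  have hM : propMatrix β h op om (fun a => ((t a : ℝ) : ℂ)) = Matrix.of fun a b : Fin n =>
      if (a : ℕ) < (b : ℕ) + 1 then
        ∑ m, F a m * G b m *
          ((Real.exp ((s a - s b) * hh.eigenvalues m) * (1 + Real.exp (β * hh.eigenvalues m))⁻¹ : ℝ) : ℂ)
      else -∑ m, F a m * G b m *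
          ((Real.exp ((s a - s b) * hh.eigenvalues m) *
            (1 + Real.exp (-(β * hh.eigenvalues m)))⁻¹ : ℝ) : ℂ) := by
    ext a b
    simp only [propMatrix, Matrix.of_apply, Nat.lt_succ_iff, Fin.le_iff_val_le_val]
    have hsab : s a - s b = t a - t b := by
      simp only [hs]
      ring
    have hnegβ : -((β : ℂ) • h) = ((-β : ℝ) : ℂ) • h := by
      rw [Complex.ofReal_neg, neg_smul]
    split_ifs with hab
    · rw [hh.propagatorKernel_apply (t a) (t b) β (om b) (op a), hsab]
      refine Finset.sum_congr rfl fun m _ => ?_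
      simp only [hF, hG]
      ring
    · rw [hnegβ, hh.propagatorKernel_apply (t a) (t b) (-β) (om b) (op a), hsab]
      congr 1
      refine Finset.sum_congr rfl fun m _ => ?_
      simp only [hF, hG, neg_mul]
      ring
  rw [hM]
  have hs01 : ∀ a, 0 ≤ s a ∧ s a ≤ β := fun a => by
    simp only [hs]
    constructor <;> linarith [(hwin a).1, (hwin a).2]
  have hcons : ∀ a b : Fin n, ((a : ℕ) < (b : ℕ) + 1 → s b ≤ s a) ∧
      (¬ (a : ℕ) < (b : ℕ) + 1 → s a ≤ s b) := fun a b => by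
    simp only [hs, Nat.lt_succ_iff]
    constructor
    · intro hab
      exact sub_le_sub_right (ht (Fin.le_def.mpr hab)) _
    · intro hab
      push Not at hab
      exact sub_le_sub_right (ht (Fin.le_def.mpr hab.le)) _
  have hPS := norm_det_timeOrdered_modes_le hh.eigenvalues β F G s s hs01 hs01
    (fun b => (b : ℕ) + 1) (fun a b hab => Nat.succ_le_succ (Fin.le_def.mp hab)) (fun b => b.isLt) hcons
  have hFn : ∀ a, Real.sqrt (∑ m, ‖F a m‖ ^ 2) = 1 := fun a => by
    simp only [hF, norm_star]
    rw [Matrix.sum_norm_sq_row_eq_one hU, Real.sqrt_one]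
  have hGn : ∀ b, Real.sqrt (∑ m, ‖G b m‖ ^ 2) = 1 := fun b => by
    simp only [hG]
    rw [Matrix.sum_norm_sq_row_eq_one hU, Real.sqrt_one]
  calc _ ≤ 2 ^ n * ((∏ a, Real.sqrt (∑ m, ‖F a m‖ ^ 2)) * ∏ b, Real.sqrt (∑ m, ‖G b m‖ ^ 2)) := hPS
    _ = 2 ^ n := by simp only [hFn, hGn, Finset.prod_const_one, mul_one]

/-- **The `2ⁿ` bound in the time convention of the tree's Dyson series**: the `k`-th Dyson term
integrates over the ordered simplex `0 ≤ u₀ ≤ ⋯ ≤ u_{k-1} ≤ 1` (`orderedIntegral`) and the pair times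
are `τₐ = -β u_{v(a)}` with the vertex `v(a)` monotone in the pair index; for `0 ≤ β` these are
antitone and lie in `[-β, 0]`, so `‖det (propMatrix β h op om τ)‖ ≤ 2ⁿ`.
[cite: PedraSalmhofer2008, Thm 2.4] -/
theorem norm_det_propMatrix_dyson_le_two_pow {h : Matrix ι ι ℂ} (hh : h.IsHermitian) {β : ℝ}
    (hβ : 0 ≤ β) {n : ℕ} (op om : Fin n → ι) (u : Fin n → ℝ) (hu : Monotone u)
    (hu01 : ∀ a, 0 ≤ u a ∧ u a ≤ 1) :
    ‖(propMatrix β h op om (fun a => ((u a : ℝ) : ℂ) * -(β : ℂ))).det‖ ≤ 2 ^ n := by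
  have hcast : (fun a => ((u a : ℝ) : ℂ) * -(β : ℂ)) = fun a => (((u a * -β : ℝ)) : ℂ) := by
    funext a
    push_cast
    ring
  rw [hcast]
  refine norm_det_propMatrix_le_two_pow hh β (-β) op om (fun a => u a * -β) ?_ ?_
  · intro a b hab
    have := hu hab
    show u b * -β ≤ u a * -β
    nlinarith
  · intro a
    constructor
    · nlinarith [(hu01 a).1, (hu01 a).2]
    · nlinarith [(hu01 a).1, (hu01 a).2]

/-! ### Shifted (tadpole-subtracted) determinants -/

/-- **The temperature-uniform bound for SHIFTED chronological propagator determinants**: for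
Hermitian `h`, real `β`, orbitals `op, om`, real antitone pair times `t` in a window of length `β`
and complex shifts `d`,
`‖det (propMatrix β h op om t − diagonal d)‖ ≤ ∏ₐ (2 + ‖dₐ‖)`
— the principal-minor expansion of the diagonal shift (`det_add_diagonal_eq_sum_minors`), the bound
`norm_det_propMatrix_le_two_pow` for every principal minor (again a chronological `propMatrix`,
`propMatrix_submatrix`), and `Σ_S ∏_{a∉S}‖dₐ‖ 2^{|S|} = ∏ₐ (2 + ‖dₐ‖)`. The Hartree counterterms
`|ν| ≤ 1` of a renormalised expansion therefore cost at most `3ⁿ`, uniformly in `β`.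
[cite: BenfattoGiulianiMastropietro2006, §2.8 (2.80)] -/
theorem norm_det_propMatrix_sub_diagonal_le_prod_two_add {h : Matrix ι ι ℂ} (hh : h.IsHermitian)
    (β τ₀ : ℝ) {n : ℕ} (op om : Fin n → ι) (t : Fin n → ℝ) (ht : Antitone t)
    (hwin : ∀ a, τ₀ ≤ t a ∧ t a ≤ τ₀ + β) (d : Fin n → ℂ) :
    ‖(propMatrix β h op om (fun a => ((t a : ℝ) : ℂ)) - Matrix.diagonal d).det‖ ≤
      ∏ a, (2 + ‖d a‖) := by
  set τ : Fin n → ℂ := fun a => ((t a : ℝ) : ℂ) with hτ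
  -- principal-minor expansion of the diagonal shift
  have hdiag : propMatrix β h op om τ - Matrix.diagonal d =
      propMatrix β h op om τ + Matrix.diagonal (fun a => -d a) := by
    ext a b
    simp only [Matrix.sub_apply, Matrix.add_apply, Matrix.diagonal_apply]
    split_ifs <;> ring
  rw [hdiag, Literature.Analysis.Matrix.det_add_diagonal_eq_sum_minors]
  -- every principal minor is a chronological propagator matrix, bounded by `2^{|S|}`
  have hminor : ∀ S : Finset (Fin n),
      ‖((propMatrix β h op om τ).submatrix ((↑) : S → Fin n) ((↑) : S → Fin n)).det‖ ≤
        ∏ _a ∈ S, (2 : ℝ) := by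
    intro S
    have hre : ((propMatrix β h op om τ).submatrix ((↑) : S → Fin n) ((↑) : S → Fin n)).det =
        ((propMatrix β h op om τ).submatrix (S.orderEmbOfFin rfl) (S.orderEmbOfFin rfl)).det := by
      have : (propMatrix β h op om τ).submatrix (S.orderEmbOfFin rfl) (S.orderEmbOfFin rfl) =
          ((propMatrix β h op om τ).submatrix ((↑) : S → Fin n) ((↑) : S → Fin n)).submatrix
            (S.orderIsoOfFin rfl).toEquiv (S.orderIsoOfFin rfl).toEquiv := by
        ext a b
        rfl
      rw [this, Matrix.det_submatrix_equiv_self]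
    rw [hre, propMatrix_submatrix, Finset.prod_const]
    exact norm_det_propMatrix_le_two_pow hh β τ₀ (op ∘ S.orderEmbOfFin rfl) (om ∘ S.orderEmbOfFin rfl)
      (t ∘ S.orderEmbOfFin rfl) (ht.comp_monotone (S.orderEmbOfFin rfl).monotone)
      (fun a => hwin _)
  -- sum up
  calc ‖∑ S : Finset (Fin n), (∏ i ∈ Sᶜ, -d i) *
        ((propMatrix β h op om τ).submatrix ((↑) : S → Fin n) ((↑) : S → Fin n)).det‖
      ≤ ∑ S : Finset (Fin n), ‖(∏ i ∈ Sᶜ, -d i) *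
          ((propMatrix β h op om τ).submatrix ((↑) : S → Fin n) ((↑) : S → Fin n)).det‖ :=
        norm_sum_le _ _
    _ ≤ ∑ S : Finset (Fin n), (∏ i ∈ Sᶜ, ‖d i‖) * ∏ _a ∈ S, (2 : ℝ) := by
        refine Finset.sum_le_sum fun S _ => ?_
        rw [norm_mul, norm_prod]
        simp only [norm_neg]
        exact mul_le_mul_of_nonneg_left (hminor S) (Finset.prod_nonneg fun i _ => norm_nonneg _)
    _ = ∏ a, ((2 : ℝ) + ‖d a‖) := by
        rw [Finset.prod_add, Finset.powerset_univ]
        refine Finset.sum_congr rfl fun S _ => ?_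
        rw [mul_comm, Finset.compl_eq_univ_sdiff]

end Literature.MathematicalPhysics.QuantumLattice
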